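import Summits.RiemannHypothesis.RiemannHypothesis.Theorems.WeilFormatCArchFarBound
import Summits.RiemannHypothesis.RiemannHypothesis.Theorems.WeilFormatCPrimeFormBound
import Summits.RiemannHypothesis.RiemannHypothesis.Theorems.WeilFormatCPolarFormBound
import Summits.RiemannHypothesis.RiemannHypothesis.Theorems.WeilFormatCSectorTransfer
import HarnessLib

/-!
# Format C: L-C3a on the actual kernel — the sector kernels of `gramCoeff a` are `⪰ diag(d̂^±)` on EVERY far truncation

Route context: Fourier–Galerkin / Schur-complement certificates of Weil positivity on a window ("format C";
cell memo `run/shared/lean/pub/rh-explicit/rh-explicit-weil-10/FORMATC-DESIGN.md` §4.3 / §4.10 / §9.1; supporting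
stmt-RiemannHypothesis-0098; seat rh-explicit-weil-10).  THIS FILE DISCHARGES HYPOTHESIS `hfar` of the soundness theorem
`WeilFormatC.sum_range_mul_mul_nonneg_of_certificate` / `weilPositivityOn_of_formatC_certificates` for
`G = Yoshida1992.gramCoeff a`, with an explicit closed-form far diagonal, by adding three landed pieces:
PRIME (`primeCoeff_form_ge`: `⪰ −A_op⁺`, through `even/odd_far_lower_const_of_modes`), POLAR
(`polarCoeff_form_nonneg_of_even` / `polarCoeff_form_ge_of_odd`, same transfer) and ARCH (`evenArch_far_ge_diag` /
`oddArch_far_ge_diag`, already sector-level).  Notation: `E = weilArchDensity (2a)`, `c_R = a(1+E)/π²`, `ω_n = πn/a`,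
`s² = (e^{a/2} − e^{−a/2})²`, `A_op⁺(a) = Σ_{k∈weilPrimeIndex a} Λ(k)k^{−1/2}·2cos(π/(⌊2a/log k⌋+2))`.

* `gramCoeff_even_far_ge_diag` — for `2 ≤ B` (block modes `0..B−1`, `M₁ = B − 1`) and all `N, y`:
  `Σ_{n∈Ico B N} d̂⁺(n) y_n² ≤ Σ_{n,m∈Ico B N} y_n M⁺(n,m) y_m` with
  `d̂⁺(n) = ½(Re ψ(¼+iω_n/2) − log π) − a(1+E)/(π²n²) − 1/(8n) − c_R√(8/(B−1)) − A_op⁺/2`;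
* `gramCoeff_odd_far_ge_diag` (and `_atan`, with `¼log((k+1+B)/B)` ↦ `½(π/2 − arctan(√B/√(k+1)))`) — for `1 ≤ B` (block = kernel indices `0..B−1` = modes `1..B`, `M₁ = B`) and all `N, z`:
  `Σ_{k∈Ico B N} d̂⁻(k) z_k² ≤ Σ_{k,l∈Ico B N} z_k M⁻(k,l) z_l` with (mode `n = k+1`)
  `d̂⁻(k) = ½(Re ψ(¼+iω_{k+1}/2) − log π) − 1/(8(k+1)) − a(1+E)/(π²(k+1)²) − ¼log((k+1+B)/B) − c_R√(8/B) − A_op⁺/2 − s²a/(π²B)`.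

Here `M⁺(n,m) = [n=0: G(0,m) | m=0: G(n,0) | (G(n,m)+G(n,−m))/2]`, `M⁻(k,l) = (G(k+1,l+1) − G(k+1,−(l+1)))/2` are weil-2's
SectorSplit kernels (M-units), exactly as consumed by `weilPositivityOn_of_formatC_certificates`.  What a rung still has to
supply per sector: `0 < d̂` on `m ≥ B` (one monotone/numeric check), the coupling majorant `hU` (L-C3b) and the kernel
certificate `hS`.  Standard axioms; no definitions; no RH claim.
-/

set_option autoImplicit false
-- `Summit.RiemannHypothesis.RiemannHypothesis.…` is the layout-mandated namespace (summit = problem name).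
set_option linter.dupNamespace false

noncomputable section

open Complex Finset
open scoped Real BigOperators ComplexConjugate ArithmeticFunction.vonMangoldt

namespace Summit.RiemannHypothesis.RiemannHypothesis.Theorems.WeilFormatC

open Literature.NumberTheory.LFunctions Literature.NumberTheory.LFunctions.Yoshida1992
open Literature.Analysis.SpecialFunctions

variable {a : ℝ}

/-! ## Real-coefficient form of the PRIME bound -/

/-- `primeCoeff_form_ge` for REAL coefficient vectors: `−A_op⁺·Σ x_n² ≤ Σ x_n x_m primeCoeff a n m`. -/
theorem primeCoeff_form_ge_real (ha : 0 < a) (s : Finset ℤ) (x : ℤ → ℝ) :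
    -((∑ k ∈ weilPrimeIndex a, (Λ k : ℝ) / Real.sqrt k * (2 * Real.cos (π / (⌊2 * a / Real.log k⌋₊ + 2)))) *
        ∑ n ∈ s, x n ^ 2)
      ≤ ∑ n ∈ s, ∑ m ∈ s, x n * x m * primeCoeff a n m := by
  have h := primeCoeff_form_ge ha s (fun n ↦ ((x n : ℝ) : ℂ))
  have e1 : ∑ n ∈ s, ‖((x n : ℝ) : ℂ)‖ ^ 2 = ∑ n ∈ s, x n ^ 2 :=
    Finset.sum_congr rfl fun n _ ↦ by rw [Complex.norm_real, Real.norm_eq_abs, sq_abs]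
  have e2 : ∑ n ∈ s, ∑ m ∈ s, (conj ((x n : ℝ) : ℂ) * ((x m : ℝ) : ℂ)).re * primeCoeff a n m
      = ∑ n ∈ s, ∑ m ∈ s, x n * x m * primeCoeff a n m :=
    Finset.sum_congr rfl fun n _ ↦ Finset.sum_congr rfl fun m _ ↦ by
      rw [Complex.conj_ofReal, ← Complex.ofReal_mul, Complex.ofReal_re]
  rw [e1, e2] at h
  exact h

/-! ## Index bookkeeping -/

/-- `Ico B N = Ioc (B−1) (N−1)` for `1 ≤ B`. -/
theorem Ico_eq_Ioc_pred {B : ℕ} (hB : 1 ≤ B) (N : ℕ) : Finset.Ico B N = Finset.Ioc (B - 1) (N - 1) := by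
  ext n
  simp only [Finset.mem_Ico, Finset.mem_Ioc]
  omega

/-- `Σ_{k∈Ico B N} f(k+1) = Σ_{n∈Ioc B N} f(n)`. -/
theorem sum_Ico_succ_eq_sum_Ioc (B N : ℕ) (f : ℕ → ℝ) :
    ∑ k ∈ Finset.Ico B N, f (k + 1) = ∑ n ∈ Finset.Ioc B N, f n := by
  rw [Finset.sum_Ico_add' f B N 1]
  congr 1
  ext n
  simp only [Finset.mem_Ico, Finset.mem_Ioc]
  omega

/-- The sector kernels off mode 0: for `n, m ≥ 1` the `if`-form of `M⁺` is `(G(n,m) + G(n,−m))/2`. -/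
theorem evenKernel_of_pos (G : ℤ → ℤ → ℝ) {n m : ℕ} (hn : 1 ≤ n) (hm : 1 ≤ m) :
    (if n = 0 then G 0 m else if m = 0 then G n 0 else (G n m + G n (-(m : ℤ))) / 2)
      = (G n m + G n (-(m : ℤ))) / 2 := by
  rw [if_neg (by omega), if_neg (by omega)]

/-! ## The far diagonal bounds for `gramCoeff` -/

section Far

/-- **L-C3a, even sector.**  For `a > 0`, `2 ≤ B` and every `N`, `y`:
`Σ_{n∈Ico B N} d̂⁺(n) y_n² ≤ Σ_{n,m∈Ico B N} y_n M⁺_{gramCoeff a}(n,m) y_m` (module docstring for `d̂⁺`). -/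
theorem gramCoeff_even_far_ge_diag (ha : 0 < a) {B : ℕ} (hB : 2 ≤ B) (N : ℕ) (y : ℕ → ℝ) :
    ∑ n ∈ Finset.Ico B N,
        ((reDigammaQuarter (freq a n) - Real.log π) / 2 - a * (1 + weilArchDensity (2 * a)) / (π ^ 2 * n ^ 2)
          - 1 / (8 * n) - a * (1 + weilArchDensity (2 * a)) / π ^ 2 * Real.sqrt (8 / ((B - 1 : ℕ) : ℝ))
          - (∑ k ∈ weilPrimeIndex a, (Λ k : ℝ) / Real.sqrt k * (2 * Real.cos (π / (⌊2 * a / Real.log k⌋₊ + 2)))) / 2)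
          * y n ^ 2
      ≤ ∑ n ∈ Finset.Ico B N, ∑ m ∈ Finset.Ico B N,
          y n * (if n = 0 then gramCoeff a 0 m else if m = 0 then gramCoeff a n 0
            else (gramCoeff a n m + gramCoeff a n (-(m : ℤ))) / 2) * y m := by
  have hB1 : 1 ≤ B := le_trans (by norm_num) hB
  have hs1 : ∀ n ∈ Finset.Ico B N, 1 ≤ n := fun n hn ↦ le_trans hB1 (Finset.mem_Ico.mp hn).1
  set Aop := ∑ k ∈ weilPrimeIndex a, (Λ k : ℝ) / Real.sqrt k * (2 * Real.cos (π / (⌊2 * a / Real.log k⌋₊ + 2)))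
    with hAop
  -- split the kernel
  have hsplit : ∀ n ∈ Finset.Ico B N, ∀ m ∈ Finset.Ico B N,
      y n * (if n = 0 then gramCoeff a 0 m else if m = 0 then gramCoeff a n 0
            else (gramCoeff a n m + gramCoeff a n (-(m : ℤ))) / 2) * y m
        = y n * (if n = 0 then polarCoeff a 0 m else if m = 0 then polarCoeff a n 0
            else (polarCoeff a n m + polarCoeff a n (-(m : ℤ))) / 2) * y m
          + y n * (if n = 0 then primeCoeff a 0 m else if m = 0 then primeCoeff a n 0
            else (primeCoeff a n m + primeCoeff a n (-(m : ℤ))) / 2) * y m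
          + y n * ((archCoeff a n m + archCoeff a n (-(m : ℤ))) / 2) * y m := by
    intro n hn m hm
    rw [evenKernel_of_pos _ (hs1 n hn) (hs1 m hm), evenKernel_of_pos _ (hs1 n hn) (hs1 m hm),
      evenKernel_of_pos _ (hs1 n hn) (hs1 m hm)]
    unfold gramCoeff
    ring
  have hform : ∑ n ∈ Finset.Ico B N, ∑ m ∈ Finset.Ico B N,
      y n * (if n = 0 then gramCoeff a 0 m else if m = 0 then gramCoeff a n 0
            else (gramCoeff a n m + gramCoeff a n (-(m : ℤ))) / 2) * y m
      = (∑ n ∈ Finset.Ico B N, ∑ m ∈ Finset.Ico B N,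
          y n * (if n = 0 then polarCoeff a 0 m else if m = 0 then polarCoeff a n 0
            else (polarCoeff a n m + polarCoeff a n (-(m : ℤ))) / 2) * y m)
        + (∑ n ∈ Finset.Ico B N, ∑ m ∈ Finset.Ico B N,
          y n * (if n = 0 then primeCoeff a 0 m else if m = 0 then primeCoeff a n 0
            else (primeCoeff a n m + primeCoeff a n (-(m : ℤ))) / 2) * y m)
        + ∑ n ∈ Finset.Ico B N, ∑ m ∈ Finset.Ico B N,
          y n * ((archCoeff a n m + archCoeff a n (-(m : ℤ))) / 2) * y m := by
    rw [← Finset.sum_add_distrib, ← Finset.sum_add_distrib]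
    refine Finset.sum_congr rfl fun n hn ↦ ?_
    rw [← Finset.sum_add_distrib, ← Finset.sum_add_distrib]
    exact Finset.sum_congr rfl fun m hm ↦ hsplit n hn m hm
  -- POLAR ⪰ 0
  have hpol := even_far_lower_const_of_modes (polarCoeff a) (polarCoeff_neg_neg a) hB1 (N := N) 0
    (fun x hx _ ↦ by rw [zero_mul]; exact polarCoeff_form_nonneg_of_even ha N x hx) y
  -- PRIME ⪰ −A_op⁺/2
  have hpri := even_far_lower_const_of_modes (primeCoeff a) (primeCoeff_neg_neg a) hB1 (N := N) (-Aop)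
    (fun x _ _ ↦ by
      have h := primeCoeff_form_ge_real ha (modes N) x
      rw [← hAop] at h
      linarith) y
  -- ARCH ⪰ diag(e⁺) with M₁ = B − 1
  have harch := evenArch_far_ge_diag ha (M₁ := B - 1) (by omega) (N - 1) y
  rw [← Ico_eq_Ioc_pred hB1 N] at harch
  -- assemble
  rw [hform]
  have hlhs : ∑ n ∈ Finset.Ico B N,
      ((reDigammaQuarter (freq a n) - Real.log π) / 2 - a * (1 + weilArchDensity (2 * a)) / (π ^ 2 * n ^ 2)
        - 1 / (8 * n) - a * (1 + weilArchDensity (2 * a)) / π ^ 2 * Real.sqrt (8 / ((B - 1 : ℕ) : ℝ))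
        - Aop / 2) * y n ^ 2
      = 0 / 2 * ∑ n ∈ Finset.Ico B N, y n ^ 2 + (-Aop) / 2 * ∑ n ∈ Finset.Ico B N, y n ^ 2
        + ∑ n ∈ Finset.Ico B N,
          ((reDigammaQuarter (freq a n) - Real.log π) / 2 - a * (1 + weilArchDensity (2 * a)) / (π ^ 2 * n ^ 2)
            - 1 / (8 * n) - a * (1 + weilArchDensity (2 * a)) / π ^ 2 * Real.sqrt (8 / ((B - 1 : ℕ) : ℝ)))
            * y n ^ 2 := by
    rw [zero_div, zero_mul, zero_add, Finset.mul_sum, ← Finset.sum_add_distrib]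
    refine Finset.sum_congr rfl fun n _ ↦ by ring
  rw [hlhs]
  exact add_le_add (add_le_add hpol hpri) harch

/-- **L-C3a, odd sector.**  For `a > 0`, `1 ≤ B` and every `N`, `z` (kernel index `k` = mode `k+1`):
`Σ_{k∈Ico B N} d̂⁻(k) z_k² ≤ Σ_{k,l∈Ico B N} z_k M⁻_{gramCoeff a}(k,l) z_l` (module docstring for `d̂⁻`). -/
theorem gramCoeff_odd_far_ge_diag (ha : 0 < a) {B : ℕ} (hB : 1 ≤ B) (N : ℕ) (z : ℕ → ℝ) :
    ∑ k ∈ Finset.Ico B N,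
        ((reDigammaQuarter (freq a ((k : ℤ) + 1)) - Real.log π) / 2 - 1 / (8 * ((k : ℝ) + 1))
          - a * (1 + weilArchDensity (2 * a)) / (π ^ 2 * ((k : ℝ) + 1) ^ 2)
          - Real.log ((((k : ℝ) + 1) + B) / B) / 4
          - a * (1 + weilArchDensity (2 * a)) / π ^ 2 * Real.sqrt (8 / B)
          - (∑ k ∈ weilPrimeIndex a, (Λ k : ℝ) / Real.sqrt k * (2 * Real.cos (π / (⌊2 * a / Real.log k⌋₊ + 2)))) / 2
          - (Real.exp (a / 2) - Real.exp (-(a / 2))) ^ 2 * a / (π ^ 2 * B))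
          * z k ^ 2
      ≤ ∑ k ∈ Finset.Ico B N, ∑ l ∈ Finset.Ico B N,
          z k * ((gramCoeff a ((k : ℤ) + 1) ((l : ℤ) + 1) - gramCoeff a ((k : ℤ) + 1) (-((l : ℤ) + 1))) / 2) * z l := by
  set Aop := ∑ k ∈ weilPrimeIndex a, (Λ k : ℝ) / Real.sqrt k * (2 * Real.cos (π / (⌊2 * a / Real.log k⌋₊ + 2)))
    with hAop
  set S2 := (Real.exp (a / 2) - Real.exp (-(a / 2))) ^ 2 with hS2
  -- split the kernel
  have hform : ∑ k ∈ Finset.Ico B N, ∑ l ∈ Finset.Ico B N,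
      z k * ((gramCoeff a ((k : ℤ) + 1) ((l : ℤ) + 1) - gramCoeff a ((k : ℤ) + 1) (-((l : ℤ) + 1))) / 2) * z l
      = (∑ k ∈ Finset.Ico B N, ∑ l ∈ Finset.Ico B N,
          z k * ((polarCoeff a ((k : ℤ) + 1) ((l : ℤ) + 1) - polarCoeff a ((k : ℤ) + 1) (-((l : ℤ) + 1))) / 2) * z l)
        + (∑ k ∈ Finset.Ico B N, ∑ l ∈ Finset.Ico B N,
          z k * ((primeCoeff a ((k : ℤ) + 1) ((l : ℤ) + 1) - primeCoeff a ((k : ℤ) + 1) (-((l : ℤ) + 1))) / 2) * z l)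
        + ∑ k ∈ Finset.Ico B N, ∑ l ∈ Finset.Ico B N,
          z k * ((archCoeff a ((k : ℤ) + 1) ((l : ℤ) + 1) - archCoeff a ((k : ℤ) + 1) (-((l : ℤ) + 1))) / 2) * z l := by
    rw [← Finset.sum_add_distrib, ← Finset.sum_add_distrib]
    refine Finset.sum_congr rfl fun k _ ↦ ?_
    rw [← Finset.sum_add_distrib, ← Finset.sum_add_distrib]
    refine Finset.sum_congr rfl fun l _ ↦ ?_
    unfold gramCoeff
    ring
  -- POLAR ⪰ −s²a/(π²B)
  have hpol := odd_far_lower_const_of_modes (polarCoeff a) (polarCoeff_neg_neg a) (B := B) (N := N)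
    (-(2 * S2 * a / (π ^ 2 * B)))
    (fun x hx hs ↦ by
      have h := polarCoeff_form_ge_of_odd ha hB N x hx (fun p hp ↦ hs p (Or.inl hp))
      rw [← hS2] at h
      exact h) z
  -- PRIME ⪰ −A_op⁺/2
  have hpri := odd_far_lower_const_of_modes (primeCoeff a) (primeCoeff_neg_neg a) (B := B) (N := N) (-Aop)
    (fun x _ _ ↦ by
      have h := primeCoeff_form_ge_real ha (modes N) x
      rw [← hAop] at h
      linarith) z
  -- ARCH ⪰ diag(e⁻) with M₁ = B, modes n = k + 1
  have harch := oddArch_far_ge_diag ha (M₁ := B) hB N (fun n ↦ z (n - 1))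
  rw [← sum_Ico_succ_eq_sum_Ioc B N, ← sum_Ico_succ_eq_sum_Ioc B N] at harch
  simp only [Nat.add_sub_cancel] at harch
  have harch' : ∑ k ∈ Finset.Ico B N,
      ((reDigammaQuarter (freq a ((k : ℤ) + 1)) - Real.log π) / 2 - 1 / (8 * ((k : ℝ) + 1))
        - a * (1 + weilArchDensity (2 * a)) / (π ^ 2 * ((k : ℝ) + 1) ^ 2)
        - Real.log ((((k : ℝ) + 1) + B) / B) / 4
        - a * (1 + weilArchDensity (2 * a)) / π ^ 2 * Real.sqrt (8 / B)) * z k ^ 2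
      ≤ ∑ k ∈ Finset.Ico B N, ∑ l ∈ Finset.Ico B N,
          z k * ((archCoeff a ((k : ℤ) + 1) ((l : ℤ) + 1) - archCoeff a ((k : ℤ) + 1) (-((l : ℤ) + 1))) / 2) * z l := by
    refine le_of_eq_of_le ?_ (harch.trans (le_of_eq ?_))
    · refine Finset.sum_congr rfl fun k _ ↦ ?_
      push_cast
      ring
    · refine Finset.sum_congr rfl fun k _ ↦ ?_
      rw [← sum_Ico_succ_eq_sum_Ioc B N]
      refine Finset.sum_congr rfl fun l _ ↦ ?_
      simp only [Nat.add_sub_cancel]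
      push_cast
      ring
  -- assemble
  rw [hform]
  have hlhs : ∑ k ∈ Finset.Ico B N,
      ((reDigammaQuarter (freq a ((k : ℤ) + 1)) - Real.log π) / 2 - 1 / (8 * ((k : ℝ) + 1))
        - a * (1 + weilArchDensity (2 * a)) / (π ^ 2 * ((k : ℝ) + 1) ^ 2)
        - Real.log ((((k : ℝ) + 1) + B) / B) / 4
        - a * (1 + weilArchDensity (2 * a)) / π ^ 2 * Real.sqrt (8 / B)
        - Aop / 2 - S2 * a / (π ^ 2 * B)) * z k ^ 2
      = (-(2 * S2 * a / (π ^ 2 * B))) / 2 * ∑ k ∈ Finset.Ico B N, z k ^ 2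
        + (-Aop) / 2 * ∑ k ∈ Finset.Ico B N, z k ^ 2
        + ∑ k ∈ Finset.Ico B N,
          ((reDigammaQuarter (freq a ((k : ℤ) + 1)) - Real.log π) / 2 - 1 / (8 * ((k : ℝ) + 1))
            - a * (1 + weilArchDensity (2 * a)) / (π ^ 2 * ((k : ℝ) + 1) ^ 2)
            - Real.log ((((k : ℝ) + 1) + B) / B) / 4
            - a * (1 + weilArchDensity (2 * a)) / π ^ 2 * Real.sqrt (8 / B)) * z k ^ 2 := by
    rw [Finset.mul_sum, Finset.mul_sum, ← Finset.sum_add_distrib, ← Finset.sum_add_distrib]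
    refine Finset.sum_congr rfl fun k _ ↦ by ring
  rw [hlhs]
  exact add_le_add (add_le_add hpol hpri) harch'

/-- **L-C3a, odd sector, arctan Hilbert weights** (the DATA pipeline's default far bound; bounded penalty
`½(π/2 − arctan(√B/√(k+1))) ≤ π/4`, convenient for the positivity check `0 < d̂`).  For `a > 0`, `1 ≤ B` and every `N`, `z` (kernel index `k` = mode `k+1`):
`Σ_{k∈Ico B N} d̂⁻(k) z_k² ≤ Σ_{k,l∈Ico B N} z_k M⁻_{gramCoeff a}(k,l) z_l` (with `¼log((k+1+B)/B)` replaced by `½(π/2 − arctan(√B/√(k+1)))` in `d̂⁻`). -/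
theorem gramCoeff_odd_far_ge_diag_atan (ha : 0 < a) {B : ℕ} (hB : 1 ≤ B) (N : ℕ) (z : ℕ → ℝ) :
    ∑ k ∈ Finset.Ico B N,
        ((reDigammaQuarter (freq a ((k : ℤ) + 1)) - Real.log π) / 2 - 1 / (8 * ((k : ℝ) + 1))
          - a * (1 + weilArchDensity (2 * a)) / (π ^ 2 * ((k : ℝ) + 1) ^ 2)
          - (π / 2 - Real.arctan (Real.sqrt B / Real.sqrt ((k : ℝ) + 1))) / 2
          - a * (1 + weilArchDensity (2 * a)) / π ^ 2 * Real.sqrt (8 / B)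
          - (∑ k ∈ weilPrimeIndex a, (Λ k : ℝ) / Real.sqrt k * (2 * Real.cos (π / (⌊2 * a / Real.log k⌋₊ + 2)))) / 2
          - (Real.exp (a / 2) - Real.exp (-(a / 2))) ^ 2 * a / (π ^ 2 * B))
          * z k ^ 2
      ≤ ∑ k ∈ Finset.Ico B N, ∑ l ∈ Finset.Ico B N,
          z k * ((gramCoeff a ((k : ℤ) + 1) ((l : ℤ) + 1) - gramCoeff a ((k : ℤ) + 1) (-((l : ℤ) + 1))) / 2) * z l := by
  set Aop := ∑ k ∈ weilPrimeIndex a, (Λ k : ℝ) / Real.sqrt k * (2 * Real.cos (π / (⌊2 * a / Real.log k⌋₊ + 2)))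
    with hAop
  set S2 := (Real.exp (a / 2) - Real.exp (-(a / 2))) ^ 2 with hS2
  -- split the kernel
  have hform : ∑ k ∈ Finset.Ico B N, ∑ l ∈ Finset.Ico B N,
      z k * ((gramCoeff a ((k : ℤ) + 1) ((l : ℤ) + 1) - gramCoeff a ((k : ℤ) + 1) (-((l : ℤ) + 1))) / 2) * z l
      = (∑ k ∈ Finset.Ico B N, ∑ l ∈ Finset.Ico B N,
          z k * ((polarCoeff a ((k : ℤ) + 1) ((l : ℤ) + 1) - polarCoeff a ((k : ℤ) + 1) (-((l : ℤ) + 1))) / 2) * z l)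
        + (∑ k ∈ Finset.Ico B N, ∑ l ∈ Finset.Ico B N,
          z k * ((primeCoeff a ((k : ℤ) + 1) ((l : ℤ) + 1) - primeCoeff a ((k : ℤ) + 1) (-((l : ℤ) + 1))) / 2) * z l)
        + ∑ k ∈ Finset.Ico B N, ∑ l ∈ Finset.Ico B N,
          z k * ((archCoeff a ((k : ℤ) + 1) ((l : ℤ) + 1) - archCoeff a ((k : ℤ) + 1) (-((l : ℤ) + 1))) / 2) * z l := by
    rw [← Finset.sum_add_distrib, ← Finset.sum_add_distrib]
    refine Finset.sum_congr rfl fun k _ ↦ ?_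
    rw [← Finset.sum_add_distrib, ← Finset.sum_add_distrib]
    refine Finset.sum_congr rfl fun l _ ↦ ?_
    unfold gramCoeff
    ring
  -- POLAR ⪰ −s²a/(π²B)
  have hpol := odd_far_lower_const_of_modes (polarCoeff a) (polarCoeff_neg_neg a) (B := B) (N := N)
    (-(2 * S2 * a / (π ^ 2 * B)))
    (fun x hx hs ↦ by
      have h := polarCoeff_form_ge_of_odd ha hB N x hx (fun p hp ↦ hs p (Or.inl hp))
      rw [← hS2] at h
      exact h) z
  -- PRIME ⪰ −A_op⁺/2
  have hpri := odd_far_lower_const_of_modes (primeCoeff a) (primeCoeff_neg_neg a) (B := B) (N := N) (-Aop)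
    (fun x _ _ ↦ by
      have h := primeCoeff_form_ge_real ha (modes N) x
      rw [← hAop] at h
      linarith) z
  -- ARCH ⪰ diag(e⁻) with M₁ = B, modes n = k + 1
  have harch := oddArch_far_ge_diag_atan ha (M₁ := B) hB N (fun n ↦ z (n - 1))
  rw [← sum_Ico_succ_eq_sum_Ioc B N, ← sum_Ico_succ_eq_sum_Ioc B N] at harch
  simp only [Nat.add_sub_cancel] at harch
  have harch' : ∑ k ∈ Finset.Ico B N,
      ((reDigammaQuarter (freq a ((k : ℤ) + 1)) - Real.log π) / 2 - 1 / (8 * ((k : ℝ) + 1))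
        - a * (1 + weilArchDensity (2 * a)) / (π ^ 2 * ((k : ℝ) + 1) ^ 2)
        - (π / 2 - Real.arctan (Real.sqrt B / Real.sqrt ((k : ℝ) + 1))) / 2
        - a * (1 + weilArchDensity (2 * a)) / π ^ 2 * Real.sqrt (8 / B)) * z k ^ 2
      ≤ ∑ k ∈ Finset.Ico B N, ∑ l ∈ Finset.Ico B N,
          z k * ((archCoeff a ((k : ℤ) + 1) ((l : ℤ) + 1) - archCoeff a ((k : ℤ) + 1) (-((l : ℤ) + 1))) / 2) * z l := by
    refine le_of_eq_of_le ?_ (harch.trans (le_of_eq ?_))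
    · refine Finset.sum_congr rfl fun k _ ↦ ?_
      push_cast
      ring
    · refine Finset.sum_congr rfl fun k _ ↦ ?_
      rw [← sum_Ico_succ_eq_sum_Ioc B N]
      refine Finset.sum_congr rfl fun l _ ↦ ?_
      simp only [Nat.add_sub_cancel]
      push_cast
      ring
  -- assemble
  rw [hform]
  have hlhs : ∑ k ∈ Finset.Ico B N,
      ((reDigammaQuarter (freq a ((k : ℤ) + 1)) - Real.log π) / 2 - 1 / (8 * ((k : ℝ) + 1))
        - a * (1 + weilArchDensity (2 * a)) / (π ^ 2 * ((k : ℝ) + 1) ^ 2)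
        - (π / 2 - Real.arctan (Real.sqrt B / Real.sqrt ((k : ℝ) + 1))) / 2
        - a * (1 + weilArchDensity (2 * a)) / π ^ 2 * Real.sqrt (8 / B)
        - Aop / 2 - S2 * a / (π ^ 2 * B)) * z k ^ 2
      = (-(2 * S2 * a / (π ^ 2 * B))) / 2 * ∑ k ∈ Finset.Ico B N, z k ^ 2
        + (-Aop) / 2 * ∑ k ∈ Finset.Ico B N, z k ^ 2
        + ∑ k ∈ Finset.Ico B N,
          ((reDigammaQuarter (freq a ((k : ℤ) + 1)) - Real.log π) / 2 - 1 / (8 * ((k : ℝ) + 1))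
            - a * (1 + weilArchDensity (2 * a)) / (π ^ 2 * ((k : ℝ) + 1) ^ 2)
            - (π / 2 - Real.arctan (Real.sqrt B / Real.sqrt ((k : ℝ) + 1))) / 2
            - a * (1 + weilArchDensity (2 * a)) / π ^ 2 * Real.sqrt (8 / B)) * z k ^ 2 := by
    rw [Finset.mul_sum, Finset.mul_sum, ← Finset.sum_add_distrib, ← Finset.sum_add_distrib]
    refine Finset.sum_congr rfl fun k _ ↦ by ring
  rw [hlhs]
  exact add_le_add (add_le_add hpol hpri) harch'

end Far

end Summit.RiemannHypothesis.RiemannHypothesis.Theorems.WeilFormatC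

end
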